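import Summits.HodgeConjecture.HodgeConjecture.Theorems.R90S10FrozenDatumDefs       -- ★ C2: `GArch`, `HArch`, `ArchOrbFamG`, `ArchOrbFamH`, `phi3`, `archDeltaPP`, ★ `IsArchDeltaTransferExists`, `ArchSmooth(₂)`
import Literature.NumberTheory.Rogawski1990.ArchCompatibleFamilies                   -- ★ `ArchCompatibleFamiliesH` ((W_H)+(C_H), print's measure convention on `H_∞`)
import Literature.NumberTheory.Automorphic.QuadraticHeckeCharacterCM                   -- ★ `quadraticHeckeCharCM` (the μ-guard `μ|_{𝕀_{L⁺}} = ω_{L∕L⁺}`)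
import HarnessLib

/-!
# R90 · S10 — LETTER `ArchShelstadQSLetter`: SHELSTAD'S ARCHIMEDEAN ENDOSCOPIC `Δ″_∞`-TRANSFER EXISTS AT THE QUASI-SPLIT PAIR
# `(G_∞, H_∞) = (U(Φ₃), U(Φ₂) × U(Φ₁))(L⁺ ⊗ ℝ)` for every compatible measure frame (DEAL #87 (R38); DEFS, 0 sorry)

Cell `hodgecm-mathlib`, crux H413 (`stmt-HodgeConjecture-24833`), route of record `HCCMUnconditional`; slab R90-TF, section S10 = §13.8; seat K2E5-p16 (g9), DEAL #87
of the S10 dealer R90-C138-plan (g4), RULING (R38) 2026-09-05T03:44:32Z «the residual `hShelQS` = Lit N3's `IsArchDeltaTransferExists` shape AT `H′ := Φ₃`, `G′ = G`,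
guard dropped, all tokens `hE`'s own = «=» AS THE ONE HONEST RESIDUAL of L-E′ … K2E5-p16 files the Defs file FIRST in the definition lane, so the payer and ED. 11 cite
the NAME».  Definition lane (`--kind definition --supports stmt-HodgeConjecture-24833 --as helper`); statement layer only — ONE `def … (L) (μ) : Prop` (a PREDICATE of the CM field and the Hecke character: closed cited Props are relocated to Literature by the
gate, where S10's Summits vocabulary `GArch ∕ ArchOrbFamG ∕ phi3 ∕ archDeltaPP` cannot elaborate — bounce p865277) + its `Iff.rfl` read-back; no instance, no notation, no axiom, no `sorry`; ★-only imports.  CONSUMERS: this seat's payer `Theorems/R90S10ArchFamiliesJR6LEOfS2.lean ::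
archFamiliesJR6LE_of_letters (hShelQS : ∀ L … μ, ArchShelstadQSLetter L μ) : ‹★ p864804 `realiseH₂_of_letters`' binder `hE` :88–:105 verbatim›`, and A ED. 11's classed
sub-socket `sock_S10_archShelstadQS : ∀ (L : Type) [Field L] [NumberField L] [IsCMField L] (μ : HeckeCharacter L), ArchShelstadQSLetter L μ` (typ3 (g3) spec note;
`sock_S10_archFamiliesJR6LE := archFamiliesJR6LE_of_letters sock_S10_archShelstadQS`).
Census: `K2/K2E5-p16/g9/CENSUS-DEAL87-JR6LE.md` (d99cb92a7d9d47db) § «residual binder».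

THE MATHEMATICS [Rogawski1990 §4.9 Prop. 4.9.1 (a) p. 55, archimedean case «a special case of the results of Shelstad ([S₁]) … to obtain `f^H` of compact support, we
use the results of Clozel–Delorme and argue as in [AC], §1.7»; §14.3 p. 234 «If `v ∈ S₀`, the existence of `f′^H_v` follows from the results of Shelstad»; §4.3 (4.3.1)
p. 43 and §1.7 p. 6 (orbital integrals with compatible measures); Shelstad1982; ClozelDelorme1984 Thm. 1; ArthurClozel1989 Ch. 1 Lemma 7.3 (i)].  For the quasi-split real
group `G_∞ = U(Φ₃)(L⁺ ⊗ ℝ) ≅ U(2,1)^{[L⁺:ℚ]}` and its elliptic endoscopic group `H_∞ = (U(Φ₂) × U(Φ₁))(L⁺ ⊗ ℝ)`, with print's transfer factor `Δ″_∞ = archDeltaPP L μ`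
(★ `archExplicitTransferFactor` at `Φ₃`) and ANY measure frame in print's convention — Haar right-invariant `νGi`, `νHi`; centraliser measures `tGi` transported under
stable conjugacy; (W) `mGi = dνGi ∕ dtGi` at the regular classes; (W_H)+(C_H) ★ `ArchCompatibleFamiliesH L νHi mHi tHi tGi` — every `f ∈ C_c^∞(G_∞)` (★ `ArchSmooth L 3 Φ₃`)
has a `Δ″_∞`-transfer `f^H ∈ C_c^∞(H_∞)` (★ `ArchSmooth₂ L`): `Φ^st(γ_H, f^H) = Σ_{[γ]} Δ″_∞(γ_H, γ) Φ([γ], f)` for all `G`-regular `γ_H` (★ `IsArchDeltaTransferExists`).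
This IS Literature N3 ★ `ArchEndoscopicTransferCompatible`'s sentence with `H′ := Φ₃` and `G′ = G`, minus its guard `hherm → ∀ hanis` (the quasi-split `Φ₃` is isotropic,
so N3 — and S6's floor `SockS6ExtArchTransferShelstad` conjunct 2, and ★ `ArchEndoscopicTransferExists` — are VACUOUS at `Φ₃`; no tree sentence concludes
`IsArchDeltaTransferExists … (phi3 L) …` today: census § (5)).  WHY IT MIGHT FAIL: only if `Δ″_∞` were not a transfer factor in Langlands–Shelstad's sense at `Φ₃` (it is
print's, §4.9) — the zero factor is excluded separately (★ `isArchNondegenerate_archDeltaPP`); the in-house N9″ road proves the same sentence at the anisotropic diagonal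
inner forms and reads anisotropy only as `det ≠ 0` ∕ `α_i ≠ 0` (E5-class refit to `Φ₃ ≅_L diag(1,1,−1)`, S6∕LH's call, DEAL #99 census).
HONEST LABEL: a letter pays nothing — `ArchShelstadQSLetter` is an UNPROVED named archimedean input (printed citation); HC_CM is proved only modulo the 7 printed
citations (2 remaining named inputs: hLiu418 = stmt-HodgeConjecture-24832, h413 = stmt-HodgeConjecture-24833) until rung 0 closes; REL ≠ ★ ≠ BUILT.

## References
* [Rogawski1990] J. D. Rogawski, *Automorphic Representations of Unitary Groups in Three Variables*, Ann. of Math. Stud. 123 (1990): §1.7 p. 6; §4.3 (4.3.1) p. 43;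
  §4.9 Prop. 4.9.1 (a) p. 55; §13.8 p. 218; §14.3 pp. 233–234.
* [Shelstad1982] D. Shelstad, *L-indistinguishability for real groups*, Math. Ann. 259 (1982), 385–430.
* [ClozelDelorme1984] L. Clozel, P. Delorme, *Le théorème de Paley–Wiener invariant pour les groupes de Lie réductifs*, Invent. Math. 77 (1984), Thm. 1.
* [ArthurClozel1989] J. Arthur, L. Clozel, *Simple Algebras, Base Change, and the Advanced Theory of the Trace Formula*, Ann. of Math. Stud. 120 (1989), Ch. 1 §7 Lemma 7.3 (i).
* [LanglandsShelstad1987] R. P. Langlands, D. Shelstad, *On the definition of transfer factors*, Math. Ann. 278 (1987), §1.3–1.4.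
-/

set_option autoImplicit false
-- the mandated namespace repeats the single-problem summit's segment (`HodgeConjecture.HodgeConjecture`)
set_option linter.dupNamespace false

noncomputable section

open NumberField MeasureTheory
open scoped Matrix MatrixGroups
open Literature.NumberTheory.Rogawski1990 Literature.NumberTheory.Automorphic Literature.NumberTheory.GaloisRepresentations

namespace Summit.HodgeConjecture.HodgeConjecture.R90.S10

/-- **LETTER `ArchShelstadQSLetter L μ`** — SHELSTAD'S ARCHIMEDEAN `Δ″_∞`-TRANSFER AT THE QUASI-SPLIT PAIR, FOR EVERY COMPATIBLE FRAME: for the CM field `L` and the Hecke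
character `μ` — IF `μ` is unitary with `μ|_{𝕀_{L⁺}} = ω_{L∕L⁺}` — and for all Haar right-invariant `νGi` on `G_∞`, `νHi` on `H_∞` (binder-supplied Borel σ-algebras), centraliser measures `tGi`,
`tHi` and orbital measure families `mGi`, `mHi` (Borel orbit quotients) with (1) the Weil form `mGi = dνGi ∕ dtGi` at the regular classes (★ `IsQuotientOf`), (2) `tGi`
transported under stable conjugacy inside `G_∞` (★ `archStableCentralizerEquiv`), (3) ★ `ArchCompatibleFamiliesH L νHi mHi tHi tGi` — the `Δ″_∞`-transfer
`C_c^∞(G_∞) → C_c^∞(H_∞)` EXISTS: ★ `IsArchDeltaTransferExists L (phi3 L) (archDeltaPP L μ) mHi mGi (ArchSmooth L 3 (phi3 L)) (ArchSmooth₂ L)`.  Binders (1)(2)(3) and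
the conclusion are ★ p864804 `realiseH₂_of_letters`' `hE` conjuncts (1)(2)(3)(5) TOKEN FOR TOKEN (= Literature N3 at `H′ := Φ₃`, `G′ = G`, anisotropy guard dropped).
[cite: Rogawski1990, §4.9 Prop. 4.9.1 (a) p. 55; §14.3 p. 234; §4.3 (4.3.1) p. 43] [cite: Shelstad1982] [cite: ClozelDelorme1984, Thm. 1]
[cite: ArthurClozel1989, Ch. 1 §7 Lemma 7.3 (i)] [cite: LanglandsShelstad1987, §1.3–1.4] -/
def ArchShelstadQSLetter (L : Type) [Field L] [NumberField L] [IsCMField L] (μ : HeckeCharacter L) : Prop :=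
  ∀ [MeasurableSpace (GArch L)] [BorelSpace (GArch L)] [MeasurableSpace (HArch L)] [BorelSpace (HArch L)],
    μ.IsUnitary →
    (∀ x : Literature.NumberTheory.GaloisRepresentations.ideleGroup ↥(maximalRealSubfield L),
      μ (AdeleRing.ideleBaseChange (↥(maximalRealSubfield L)) L x) = quadraticHeckeCharCM L x) →
    ∀ (νGi : Measure (GArch L)) [νGi.IsHaarMeasure] [νGi.IsMulRightInvariant] (νHi : Measure (HArch L)) [νHi.IsHaarMeasure] [νHi.IsMulRightInvariant]
      (tGi : ∀ γ : GArch L, Measure (Subgroup.centralizer ({γ} : Set (GArch L))))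
      (tHi : ∀ a : HArch L, Measure (Subgroup.centralizer ({a} : Set (HArch L)))) (mGi : ArchOrbFamG L) (mHi : ArchOrbFamH L),
      (letI : ∀ γ : GArch L, MeasurableSpace (GArch L ⧸ Subgroup.centralizer ({γ} : Set (GArch L))) := fun _ => borel _
       haveI : ∀ γ : GArch L, BorelSpace (GArch L ⧸ Subgroup.centralizer ({γ} : Set (GArch L))) := fun _ => ⟨rfl⟩
       mGi.IsQuotientOf (fun γ => IsRegularElt (γ.val : GL (Fin 3) (mixedEmbedding.mixedSpace L))) νGi tGi) →
      (∀ (γ₁ γ₂ : GArch L)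
          (h₁ : IsRegularElt (γ₁.val : GL (Fin 3) (mixedEmbedding.mixedSpace L)))
          (hc : Corresponds (UnitaryGroup.conjMixed (↥(maximalRealSubfield L)) L (IsCMField.complexConj L))
            (UnitaryGroup.archFormOf L 3 (phi3 L)) (UnitaryGroup.archFormOf L 3 (phi3 L)) γ₁ γ₂),
          Measure.map ⇑(UnitaryGroup.archStableCentralizerEquiv L (UnitaryGroup.isUnit_antidiagOne_det L 3).ne_zero
            (UnitaryGroup.isUnit_antidiagOne_det L 3).ne_zero hc h₁) (tGi γ₁) = tGi γ₂) →
      ArchCompatibleFamiliesH L νHi mHi tHi tGi →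
      IsArchDeltaTransferExists L (phi3 L) (archDeltaPP L μ) mHi mGi (ArchSmooth L 3 (phi3 L)) (ArchSmooth₂ L)

/-- Read-back, `Iff.rfl` (byte guard: a consumer binding `(h : ArchShelstadQSLetter L μ)` reads the ∀-sentence by `(archShelstadQSLetter_iff L μ).1 h`; a drift of either side breaks this line).
[cite: Rogawski1990, §4.9 Prop. 4.9.1 (a) p. 55; §14.3 p. 234] -/
theorem archShelstadQSLetter_iff (L : Type) [Field L] [NumberField L] [IsCMField L] (μ : HeckeCharacter L) :
    ArchShelstadQSLetter L μ ↔
      ∀ [MeasurableSpace (GArch L)] [BorelSpace (GArch L)] [MeasurableSpace (HArch L)] [BorelSpace (HArch L)],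
        μ.IsUnitary →
        (∀ x : Literature.NumberTheory.GaloisRepresentations.ideleGroup ↥(maximalRealSubfield L),
          μ (AdeleRing.ideleBaseChange (↥(maximalRealSubfield L)) L x) = quadraticHeckeCharCM L x) →
        ∀ (νGi : Measure (GArch L)) [νGi.IsHaarMeasure] [νGi.IsMulRightInvariant] (νHi : Measure (HArch L)) [νHi.IsHaarMeasure] [νHi.IsMulRightInvariant]
          (tGi : ∀ γ : GArch L, Measure (Subgroup.centralizer ({γ} : Set (GArch L))))
          (tHi : ∀ a : HArch L, Measure (Subgroup.centralizer ({a} : Set (HArch L)))) (mGi : ArchOrbFamG L) (mHi : ArchOrbFamH L),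
          (letI : ∀ γ : GArch L, MeasurableSpace (GArch L ⧸ Subgroup.centralizer ({γ} : Set (GArch L))) := fun _ => borel _
           haveI : ∀ γ : GArch L, BorelSpace (GArch L ⧸ Subgroup.centralizer ({γ} : Set (GArch L))) := fun _ => ⟨rfl⟩
           mGi.IsQuotientOf (fun γ => IsRegularElt (γ.val : GL (Fin 3) (mixedEmbedding.mixedSpace L))) νGi tGi) →
          (∀ (γ₁ γ₂ : GArch L)
              (h₁ : IsRegularElt (γ₁.val : GL (Fin 3) (mixedEmbedding.mixedSpace L)))
              (hc : Corresponds (UnitaryGroup.conjMixed (↥(maximalRealSubfield L)) L (IsCMField.complexConj L))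
                (UnitaryGroup.archFormOf L 3 (phi3 L)) (UnitaryGroup.archFormOf L 3 (phi3 L)) γ₁ γ₂),
              Measure.map ⇑(UnitaryGroup.archStableCentralizerEquiv L (UnitaryGroup.isUnit_antidiagOne_det L 3).ne_zero
                (UnitaryGroup.isUnit_antidiagOne_det L 3).ne_zero hc h₁) (tGi γ₁) = tGi γ₂) →
          ArchCompatibleFamiliesH L νHi mHi tHi tGi →
          IsArchDeltaTransferExists L (phi3 L) (archDeltaPP L μ) mHi mGi (ArchSmooth L 3 (phi3 L)) (ArchSmooth₂ L) :=
  Iff.rfl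

end Summit.HodgeConjecture.HodgeConjecture.R90.S10

end
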